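import Literature.Geometry.Kaehler.ComplexTorusAnalyticCycleClassIntegral
import Literature.AlgebraicGeometry.HodgeTheory.ComplexTorusSubtorusCycleClassComparison
import HarnessLib

/-!
# The cycle class of a closed analytic subset of a complex torus in the model layer

Layer `Literature/AlgebraicGeometry/HodgeTheory`; lane `lit-hodgefound`, Layer A4, rows A4-18 (b)/(c) and
A4-01 (`SKELETON.md`: TRIBUNAL-A — A4-01 `Motives.BettiCycleData` is MODEL-RELATIVE, its
CONCRETE-INSTANTIATION is A4-18; p09's `ComplexTorusSubtorusCycleClassComparison.lean` did the sub-torus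
case). The concrete objects: the complex torus `X = E/Φ(ℤ^ι)` (`ComplexTorus Φ`), a closed analytic subset
`Z ⊆ X` of pure dimension `d` and codimension `p` (`2d + 2p = rk Λ`), and its cycle class
`[Z] = (∫_Z ·)^♭ ∈ H^{2p}(X, ℤ) ∩ H^{p,p}` (`ComplexTorus.analyticCycleClass`, rows p07:
`ComplexTorusAnalyticCycleClass.lean`, `…Integral.lean` — an integral Hodge class, unconditionally,
`analyticCycleClass_mem_integralHodgeClasses_unconditional`). The MODEL carriers of
`AlgebraicGeometry/HodgeTheory`: singular classes with `IsRationalClass` and the de Rham subspaces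
`hodgePQ E M k p q = H^{p,q}(M)`, tied by a complex de Rham isomorphism family (`ComplexDeRhamIsoFamily`),
rationally normalised (`IsRationalDeRhamFamily`). By `hodgeClasses_comparison`:

* `cconstClass_analyticCycleClass_mem_hodgePQ` — the de Rham class of `[Z]` lies in `H^{p,p}(X)` (Voisin
  (2002), Prop. 11.20);
* `analyticCycleClass_comparison` — under a rationally normalised family, the singular class of `[Z]` is a
  rational class with de Rham class of type `(p,p)`: a Hodge class of `X` in the sense of the model layer;
* `exists_isRationalClass_analyticCycleClass` — unconditionally, with the tree's natural rationally
  normalised family: "the class of an analytic cycle is a Hodge class" (Voisin (2002), Thm. 11.31 /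
  Prop. 11.20) for every closed analytic subset of pure dimension of a complex torus.

No definition, no named fact.

## References

* [VoisinHodgeI2002] C. Voisin, *Hodge Theory and Complex Algebraic Geometry I*, CUP (2002), §11.1.2,
  §11.1.3 Prop. 11.20, §11.3 Thm. 11.31.
* [Lange2023AbelianVarietiesComplex] H. Lange, *Abelian Varieties over the Complex Numbers*, Springer
  (2023), §6.2.1 Lemma 6.2.7.
-/

noncomputable section

open scoped Manifold ContDiff
open Literature.NumberTheory.Transcendental Literature.Geometry.Kaehler

namespace Literature.AlgebraicGeometry.HodgeTheory

section AnalyticComparison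

variable {ι : Type} [Fintype ι] [DecidableEq ι] {E : Type} [NormedAddCommGroup E] [InnerProductSpace ℂ E]
  [FiniteDimensional ℂ E] [MeasurableSpace E] [BorelSpace E] (Φ : (ι → ℝ) ≃L[ℝ] E) {n : ℕ}
  (eι : Fin n ≃ ι) {d p : ℕ}

/-- **The de Rham class of the cycle class of a closed analytic subset lies in `H^{p,p}(X)`** (Voisin
(2002), Prop. 11.20: "The image in `H^{2r}(X, ℂ)` of the class `[Z] ∈ H^{2r}(X, ℤ)` lies in `H^{r,r}(X)`"),
for `Z ⊆ X = E/Φ(ℤ^ι)` closed analytic of pure dimension `d`, `2d + 2p = n = |ι|`.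
[cite: VoisinHodgeI2002, §11.1.3 Prop. 11.20] -/
theorem cconstClass_analyticCycleClass_mem_hodgePQ (h : 2 * d + 2 * p = n) {Z : Set (ComplexTorus Φ)}
    (hZ : HasPureDim 𝓘(ℂ, E) Z d) :
    ComplexTorus.cconstClass Φ (ComplexTorus.analyticCycleClass Φ eι h hZ) ∈
      hodgePQ E (ComplexTorus Φ) (2 * p) p p :=
  cconstClass_mem_hodgePQ_of_mem_hodgeClasses Φ
    (ComplexTorus.analyticCycleClass_mem_hodgeClasses_unconditional Φ eι h hZ)

/-- **The cycle class of a closed analytic subset is a rational `(p,p)`-class in the model layer**: under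
a rationally normalised complex de Rham isomorphism family `e` (degree `2p`), the singular class
`e[Z] ∈ H^{2p}(X; ℂ)` is a rational class (`IsRationalClass`) and its de Rham class lies in `H^{p,p}(X)`
— the concrete instantiation, for closed analytic subsets of complex tori, of "the class of an analytic
cycle is a Hodge class" (Voisin (2002), Thm. 11.31) beneath the model-relative cycle class of row A4-01.
[cite: VoisinHodgeI2002, §11.3 Thm. 11.31] -/
theorem analyticCycleClass_comparison (h : 2 * d + 2 * p = n) {Z : Set (ComplexTorus Φ)}
    (hZ : HasPureDim 𝓘(ℂ, E) Z d) {e : ComplexDeRhamIsoFamily E} (he : IsRationalDeRhamFamily e (2 * p)) :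
    IsRationalClass (e (ComplexTorus Φ) (2 * p)
        (ComplexTorus.cconstClass Φ (ComplexTorus.analyticCycleClass Φ eι h hZ))) ∧
      ComplexTorus.cconstClass Φ (ComplexTorus.analyticCycleClass Φ eι h hZ) ∈
        hodgePQ E (ComplexTorus Φ) (2 * p) p p :=
  hodgeClasses_comparison Φ he (ComplexTorus.analyticCycleClass_mem_hodgeClasses_unconditional Φ eι h hZ)

/-- **Unconditional form**: there is a NATURAL complex de Rham isomorphism family `e` on `E`, rationally
normalised in every degree (`exists_isRational_complexDeRhamIsoFamily_holds`), under which the cycle class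
of EVERY closed analytic subset of pure dimension of `X = E/Φ(ℤ^ι)` (every dimension `d`, codimension `p`,
`2d + 2p = |ι|`) is a rational class with de Rham class in `H^{p,p}(X)`.
[cite: VoisinHodgeI2002, §11.3 Thm. 11.31] -/
theorem exists_isRationalClass_analyticCycleClass :
    ∃ e : ComplexDeRhamIsoFamily E, e.IsNatural ∧
      ∀ {d p : ℕ} (h : 2 * d + 2 * p = n) {Z : Set (ComplexTorus Φ)} (hZ : HasPureDim 𝓘(ℂ, E) Z d),
        IsRationalClass (e (ComplexTorus Φ) (2 * p)
            (ComplexTorus.cconstClass Φ (ComplexTorus.analyticCycleClass Φ eι h hZ))) ∧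
          ComplexTorus.cconstClass Φ (ComplexTorus.analyticCycleClass Φ eι h hZ) ∈
            hodgePQ E (ComplexTorus Φ) (2 * p) p p := by
  obtain ⟨e, hnat, hrat⟩ := exists_isRational_complexDeRhamIsoFamily_holds E
  exact ⟨e, hnat, fun h _ hZ ↦ analyticCycleClass_comparison Φ eι h hZ (hrat _)⟩

end AnalyticComparison

end Literature.AlgebraicGeometry.HodgeTheory
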